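import Summits.CriticalPhenomena.Ising3D.Control2DReadoutTailSpin
import Summits.CriticalPhenomena.Ising3D.Control2DReadoutFastVec
import Summits.CriticalPhenomena.Ising3D.Control2DReadoutCheck
import Mathlib.Tactic.Linarith
import Mathlib.Tactic.Positivity
import Mathlib.Tactic.FieldSimp
import Mathlib.Tactic.Ring
import Mathlib.Tactic.NormNum
import HarnessLib

/-!
# Readout certificates for SPINNING channels, kernel half: exact rational heads for the weight pair `(h, h̄)`, the error radius
of `abs_phi_block_sub_QN_le_spin`, the enclosure, ONE Boolean check per object and its soundness (cell `pub-ising3x`, seat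
controls-1 gen 30; KERNEL PATH, certificate kind "readout", spin-`ℓ` extension — CONTROL-ONLY)

HONEST FRAMING: lottery ticket; floor = tightest certified 3D Ising CFT bounds; no exact-solution
claim without a proof. CONTROL-ONLY (`d = 2`, `Δ_σ = 1/8`); nothing numerical is asserted here.

The scalar readout kind (`Control2DReadoutKernel` / `Control2DReadoutCheck`, controls-1 g29) encloses `φ[F^{1/8}_-[g_{Δ,0}]]` for an
integer table functional `φ = taylorFunctional2D (1/2) Sl.toFinset wt` between `halfPow Δ · (headQ ∓ errQ)`. For spin `ℓ` the truncated
action is the same separable rational form with TWO chiral weights (`taylorFunctional2D_half_crossF_QN`):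
`φ[F_-[Q_N(Δ,ℓ)]] = halfPow Δ · Σ_p wt_p c_p (u_{p₁}(h) u_{p₂}(h̄) + u_{p₁}(h̄) u_{p₂}(h))`, `h = (Δ+ℓ)/2`, `h̄ = (Δ-ℓ)/2` — the
ℚ-mirror `headSpinQ` (kernel form `headSpinQf`: the two `u`-vectors are the FAST vectors `Control2DReadoutFastVec.uVecF` — binomial rows in one pass, one final convolution — computed once and looked up), and the dropped tail is
bounded by `Control2DReadoutTailSpin.abs_phi_block_sub_QN_le_spin`, whose radius is the ℚ-mirror `errSpinQ` (peak chiral coefficients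
`peakQ c = a_{c²-2c}(c)`, kept majorant head `headMajorQ`, `tailMajorQ`; it does not depend on `Δ`). Hence the enclosure
`blockAction_mem_spin` (`ℓ < Δ ≤ 2k + ℓ`, `0 < k`, `Λ < N + (k+ℓ) + 2`), the Boolean `readoutCheckSpin wt Sl Λ N ℓ k t a m b` (ranges +
the three displaced-dip comparisons between enclosure ends, exactly as `readoutCheck`) and its soundness `dip_of_readoutCheckSpin`:
`f(m) < f(a)`, `f(m) < f(b)`, `f(m) < f(t)` for `f(x) = φ[F^{1/8}_-[g_{x,ℓ}]]` — the body of a `DisplacedDip φ (1/8) ℓ t a m b` node of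
`Control2DConjectureCF`. First use: the `ℓ = 2` channel of the C-F objects B11 … B19 (E-3's `δ₂` sequence), `Control2DReadoutSpin2B*`.
Elementary; no facts, standard axioms only. [cite: RattazziEtAl2008, §5.5]
-/

namespace Summit.CriticalPhenomena.Ising3D.Control2D

open Finset Set
open Literature.MathematicalPhysics.QuantumFieldTheory.ConformalBootstrap3D

/-! ### ℚ-mirrors for the weight pair `(h, h̄)` -/

/-- **The rational head, spin `ℓ`**: `Σ_{p ∈ Sl} wt_p c_p (u_{p₁}(h) u_{p₂}(h̄) + u_{p₁}(h̄) u_{p₂}(h))` (for `h = h̄` this is the scalar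
`headQ`). [folklore] -/
def headSpinQ (wt : ℕ × ℕ → ℤ) (Sl : List (ℕ × ℕ)) (s h hb : ℚ) (N : ℕ) : ℚ :=
  (Sl.map fun p => (wt p : ℚ) * cfacQ p * (uSumQ s h N p.1 * uSumQ s hb N p.2 + uSumQ s hb N p.1 * uSumQ s h N p.2)).sum

/-- [folklore] -/
theorem cast_headSpinQ (wt : ℕ × ℕ → ℤ) {Sl : List (ℕ × ℕ)} (hnd : Sl.Nodup) (s : ℚ) {h hb : ℚ} (hh : 0 < h) (hhb : 0 < hb)
    (N : ℕ) :
    ((headSpinQ wt Sl s h hb N : ℚ) : ℝ) =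
      ∑ p ∈ Sl.toFinset, (wt p : ℝ) * cfac p *
        (uSum (s : ℝ) N (h : ℝ) p.1 * uSum (s : ℝ) N (hb : ℝ) p.2 + uSum (s : ℝ) N (hb : ℝ) p.1 * uSum (s : ℝ) N (h : ℝ) p.2) := by
  rw [headSpinQ, List.sum_toFinset _ hnd, Rat.cast_list_sum, List.map_map]
  congr 1
  refine List.map_congr_left fun p _ => ?_
  simp only [Function.comp_apply]
  push_cast
  simp only [cast_cfacQ, cast_uSumQ s hh, cast_uSumQ s hhb]

/-- **The rational head, kernel form** (what `decide` evaluates): both `u`-vectors are the fast vectors `uVecF`, computed once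
and looked up. [folklore] -/
def headSpinQf (wt : ℕ × ℕ → ℤ) (Sl : List (ℕ × ℕ)) (s h hb : ℚ) (N Λ : ℕ) : ℚ :=
  let us := uVecF s h N Λ
  let vs := uVecF s hb N Λ
  (Sl.map fun p => (wt p : ℚ) * cfacQ p * (us[p.1]?.getD 0 * vs[p.2]?.getD 0 + vs[p.1]?.getD 0 * us[p.2]?.getD 0)).sum

/-- [folklore] -/
theorem headSpinQf_eq_headSpinQ (wt : ℕ × ℕ → ℤ) {Sl : List (ℕ × ℕ)} {Λ : ℕ} (hdeg : ∀ p ∈ Sl, p.1 + p.2 ≤ Λ)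
    (s h hb : ℚ) (N : ℕ) : headSpinQf wt Sl s h hb N Λ = headSpinQ wt Sl s h hb N := by
  dsimp only [headSpinQf, headSpinQ]
  congr 1
  refine List.map_congr_left fun p hp => ?_
  have h1 : p.1 ≤ Λ := by have := hdeg p hp; omega
  have h2 : p.2 ≤ Λ := by have := hdeg p hp; omega
  simp only [uVecF_getD s h N Λ h1, uVecF_getD s h N Λ h2, uVecF_getD s hb N Λ h1, uVecF_getD s hb N Λ h2]

/-- The peak chiral coefficient `a_{c²-2c}(c)` over `ℚ` (`Control2DReadoutTailSpin.chiralCoeff_le_peak`). [folklore] -/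
def peakQ (c : ℕ) : ℚ := aQ c (c * c - 2 * c)

/-- [folklore] -/
theorem cast_peakQ {c : ℕ} (hc : 0 < c) : ((peakQ c : ℚ) : ℝ) = chiralCoeff (c : ℝ) (c * c - 2 * c) := by
  have hc' : (0 : ℚ) < (c : ℚ) := by exact_mod_cast hc
  rw [peakQ, cast_aQ hc', Rat.cast_natCast]

/-- The kept head `Σ_{m<N} 2^{-m} C(m+Λ+c+1, Λ)` of the majorant series over `ℚ`. [folklore] -/
def headMajorQ (Λ c N : ℕ) : ℚ := sumRangeQ (fun m => (1 / 2) ^ m * chooseQ ((m + Λ + c + 1 : ℕ) : ℚ) Λ) N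

/-- [folklore] -/
theorem cast_headMajorQ (Λ c N : ℕ) :
    ((headMajorQ Λ c N : ℚ) : ℝ) = ∑ m ∈ range N, (1 / 2 : ℝ) ^ m * (((m + Λ + c + 1).choose Λ : ℕ) : ℝ) := by
  rw [headMajorQ, cast_sumRangeQ]
  refine Finset.sum_congr rfl fun m _ => ?_
  rw [Rat.cast_mul, cast_chooseQ_natCast]
  push_cast; ring

/-- **The rational error radius** `2W · A_c A_k · σ(2 S_N + σ)` of `abs_phi_block_sub_QN_le_spin` (`c = k + ℓ`, `σ = 2^{c+1} τ`);
independent of `Δ`. [folklore] -/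
def errSpinQ (wt : ℕ × ℕ → ℤ) (Sl : List (ℕ × ℕ)) (ℓ k N Λ : ℕ) : ℚ :=
  2 * absWeightQ wt Sl * (peakQ (k + ℓ) * peakQ k) *
    ((2 ^ (k + ℓ + 1) * tailMajorQ Λ (N + (k + ℓ) + 1)) *
      (2 * headMajorQ Λ (k + ℓ) N + 2 ^ (k + ℓ + 1) * tailMajorQ Λ (N + (k + ℓ) + 1)))

/-- [folklore] -/
theorem cast_errSpinQ (wt : ℕ × ℕ → ℤ) {Sl : List (ℕ × ℕ)} (hnd : Sl.Nodup) (ℓ : ℕ) {k : ℕ} (hk : 0 < k) (N Λ : ℕ) :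
    ((errSpinQ wt Sl ℓ k N Λ : ℚ) : ℝ) =
      2 * absWeight Sl.toFinset (fun p => (wt p : ℝ)) *
        (chiralCoeff ((k + ℓ : ℕ) : ℝ) ((k + ℓ) * (k + ℓ) - 2 * (k + ℓ)) * chiralCoeff (k : ℝ) (k * k - 2 * k)) *
        ((2 ^ (k + ℓ + 1) * tailMajor Λ (N + (k + ℓ) + 1)) *
          (2 * (∑ m ∈ range N, (1 / 2 : ℝ) ^ m * (((m + Λ + (k + ℓ) + 1).choose Λ : ℕ) : ℝ)) +
            2 ^ (k + ℓ + 1) * tailMajor Λ (N + (k + ℓ) + 1))) := by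
  simp only [errSpinQ, Rat.cast_mul, Rat.cast_add, Rat.cast_pow, Rat.cast_ofNat, cast_absWeightQ wt hnd,
    cast_peakQ (show 0 < k + ℓ by omega), cast_peakQ hk, cast_tailMajorQ, cast_headMajorQ]

/-! ### The enclosure of the spin-`ℓ` action at a rational dimension -/

/-- **Enclosure of the spin-`ℓ` action at a rational dimension** (`Δ_σ = 1/8`): for the integer table `wt` on the duplicate-free index
list `Sl` (all `p₁ + p₂ ≤ Λ`), `ℓ < Δ ≤ 2k + ℓ`, `0 < k`, `Λ < N + (k+ℓ) + 2`:
`halfPow Δ · (headSpinQ - errSpinQ) ≤ φ[F_-[g_{Δ,ℓ}]] ≤ halfPow Δ · (headSpinQ + errSpinQ)` (`h = (Δ+ℓ)/2`, `h̄ = (Δ-ℓ)/2`).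
[cite: RattazziEtAl2008, §5.5] -/
theorem blockAction_mem_spin (wt : ℕ × ℕ → ℤ) {Sl : List (ℕ × ℕ)} (hnd : Sl.Nodup) {Λ : ℕ}
    (hdeg : ∀ p ∈ Sl, p.1 + p.2 ≤ Λ) (ℓ : ℕ) {k : ℕ} (hk : 0 < k) {Δ : ℚ} (hℓΔ : (ℓ : ℚ) < Δ) (hΔk : Δ ≤ 2 * k + ℓ)
    {N : ℕ} (hN : Λ < N + (k + ℓ) + 2) :
    halfPow (Δ : ℝ) * (((headSpinQ wt Sl (1 / 8) ((Δ + ℓ) / 2) ((Δ - ℓ) / 2) N - errSpinQ wt Sl ℓ k N Λ : ℚ) : ℝ)) ≤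
        taylorFunctional2D (1 / 2) Sl.toFinset (fun p => (wt p : ℝ)) (crossF (1 / 8) (-1) (globalBlock (Δ : ℝ) ℓ)) ∧
      taylorFunctional2D (1 / 2) Sl.toFinset (fun p => (wt p : ℝ)) (crossF (1 / 8) (-1) (globalBlock (Δ : ℝ) ℓ)) ≤
        halfPow (Δ : ℝ) * (((headSpinQ wt Sl (1 / 8) ((Δ + ℓ) / 2) ((Δ - ℓ) / 2) N + errSpinQ wt Sl ℓ k N Λ : ℚ) : ℝ)) := by
  set φ := taylorFunctional2D (1 / 2) Sl.toFinset (fun p => (wt p : ℝ)) with hφ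
  have hΛ : ∀ p ∈ Sl.toFinset, p.1 ≤ Λ ∧ p.2 ≤ Λ := by
    intro p hp
    have := hdeg p (List.mem_toFinset.mp hp)
    exact ⟨by omega, by omega⟩
  have hℓR : ((ℓ : ℕ) : ℝ) ≤ (Δ : ℝ) := by
    have : ((ℓ : ℚ) : ℝ) ≤ (Δ : ℝ) := by exact_mod_cast hℓΔ.le
    simpa using this
  have hΔRk : (Δ : ℝ) ≤ 2 * (k : ℝ) + (ℓ : ℝ) := by exact_mod_cast hΔk
  -- the tail bound
  have htail := abs_phi_block_sub_QN_le_spin Sl.toFinset (fun p => (wt p : ℝ)) (s := 1 / 8) (by norm_num) (by norm_num)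
    hΛ ℓ hk hℓR hΔRk hN
  -- the head in closed form
  have hhead := taylorFunctional2D_half_crossF_QN Sl.toFinset (fun p => (wt p : ℝ)) (1 / 8 : ℝ) hℓR N
  have e1 : ((Δ : ℝ) + ((ℓ : ℕ) : ℝ)) / 2 = ((((Δ + ℓ) / 2 : ℚ)) : ℝ) := by push_cast; ring
  have e2 : ((Δ : ℝ) - ((ℓ : ℕ) : ℝ)) / 2 = ((((Δ - ℓ) / 2 : ℚ)) : ℝ) := by push_cast; ring
  rw [e1, e2] at hhead
  have hh : (0 : ℚ) < (Δ + ℓ) / 2 := by have : (0 : ℚ) ≤ ℓ := Nat.cast_nonneg ℓ; linarith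
  have hhb : (0 : ℚ) < (Δ - ℓ) / 2 := by linarith
  have hH := cast_headSpinQ wt hnd (1 / 8) hh hhb N
  have hs8 : (((1 / 8 : ℚ)) : ℝ) = 1 / 8 := by norm_num
  rw [hs8] at hH
  rw [← hH] at hhead
  -- assemble
  have hE := cast_errSpinQ wt hnd ℓ hk N Λ
  have hP : halfPow (Δ : ℝ) = (1 / 2 : ℝ) ^ (1 / 8 : ℝ) * (1 / 2 : ℝ) ^ (1 / 8 : ℝ) * (1 / 2 : ℝ) ^ (Δ : ℝ) := rfl
  rw [hhead] at htail
  have hbound : |φ (crossF (1 / 8) (-1) (globalBlock (Δ : ℝ) ℓ)) -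
      halfPow (Δ : ℝ) * ((headSpinQ wt Sl (1 / 8) ((Δ + ℓ) / 2) ((Δ - ℓ) / 2) N : ℚ) : ℝ)| ≤
      halfPow (Δ : ℝ) * ((errSpinQ wt Sl ℓ k N Λ : ℚ) : ℝ) := by
    rw [hE, hP]
    refine htail.trans (le_of_eq ?_)
    ring
  obtain ⟨h1, h2⟩ := abs_le.mp hbound
  push_cast
  constructor <;> nlinarith [h1, h2]

/-! ### The Boolean readout check for spin `ℓ` and its soundness -/

/-- Range conditions of the spin-`ℓ` enclosure at one dimension (`ℓ < Δ ≤ 2k + ℓ`). [folklore] -/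
def rangeOkSpin (ℓ k : ℕ) (Δ : ℚ) : Bool :=
  decide ((ℓ : ℚ) < Δ) && decide (Δ ≤ 2 * k + ℓ)

/-- [folklore] -/
theorem rangeOkSpin_sound {ℓ k : ℕ} {Δ : ℚ} (h : rangeOkSpin ℓ k Δ = true) : (ℓ : ℚ) < Δ ∧ Δ ≤ 2 * k + ℓ := by
  unfold rangeOkSpin at h
  simp only [Bool.and_eq_true, decide_eq_true_eq] at h
  exact h

/-- **The spin-`ℓ` readout check** of a displaced dip at `Δ_σ = 1/8` for the integer table `wt` on `Sl` (indices `≤ Λ`), truncation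
`N`, room `k`, true level `t`, bracket `a < m < b` (`b ≤ m + 1`): ranges, and with `L(x) = head(x) - err`, `U(x) = head(x) + err`:
`0 < L(a)`, `U(m) ≤ L(a)`; `0 < L(t)`, `U(m) ≤ L(t)`; `0 < L(b)`, `2 U(m) < L(b)`. This is what `decide` evaluates. [folklore] -/
def readoutCheckSpin (wt : ℕ × ℕ → ℤ) (Sl : List (ℕ × ℕ)) (Λ N ℓ k : ℕ) (t a m b : ℚ) : Bool :=
  let H := fun Δ : ℚ => headSpinQf wt Sl (1 / 8) ((Δ + ℓ) / 2) ((Δ - ℓ) / 2) N Λ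
  let E := errSpinQ wt Sl ℓ k N Λ
  rangeOkSpin ℓ k t && rangeOkSpin ℓ k a && rangeOkSpin ℓ k m && rangeOkSpin ℓ k b &&
    decide (0 < k) && decide (Λ < N + (k + ℓ) + 2) &&
    decide (a < m) && decide (t < m) && decide (m < b) && decide (b ≤ m + 1) &&
    decide (0 < H a - E) && decide (H m + E ≤ H a - E) &&
    decide (0 < H t - E) && decide (H m + E ≤ H t - E) &&
    decide (0 < H b - E) && decide (2 * (H m + E) < H b - E)

/-- **Soundness of the spin-`ℓ` readout check** (`Δ_σ = 1/8`): `readoutCheckSpin wt Sl Λ N ℓ k t a m b = true` for the integer table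
`wt` on the duplicate-free list `Sl` (all `p₁ + p₂ ≤ Λ`) gives the displaced-dip inequalities of the table functional
`φ = taylorFunctional2D (1/2) Sl.toFinset wt` in the spin-`ℓ` channel: `f(m) < f(a)`, `f(m) < f(b)`, `f(m) < f(t)` with
`f(x) = φ[F^{1/8}_-[g_{x,ℓ}]]`. [cite: RattazziEtAl2008, §5.5] -/
theorem dip_of_readoutCheckSpin (wt : ℕ × ℕ → ℤ) {Sl : List (ℕ × ℕ)} (hnd : Sl.Nodup) {Λ : ℕ}
    (hdeg : ∀ p ∈ Sl, p.1 + p.2 ≤ Λ) {N ℓ k : ℕ} {t a m b : ℚ}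
    (hchk : readoutCheckSpin wt Sl Λ N ℓ k t a m b = true) :
    taylorFunctional2D (1 / 2) Sl.toFinset (fun p => (wt p : ℝ)) (crossF (1 / 8) (-1) (globalBlock (m : ℝ) ℓ)) <
        taylorFunctional2D (1 / 2) Sl.toFinset (fun p => (wt p : ℝ)) (crossF (1 / 8) (-1) (globalBlock (a : ℝ) ℓ)) ∧
      taylorFunctional2D (1 / 2) Sl.toFinset (fun p => (wt p : ℝ)) (crossF (1 / 8) (-1) (globalBlock (m : ℝ) ℓ)) <
        taylorFunctional2D (1 / 2) Sl.toFinset (fun p => (wt p : ℝ)) (crossF (1 / 8) (-1) (globalBlock (b : ℝ) ℓ)) ∧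
      taylorFunctional2D (1 / 2) Sl.toFinset (fun p => (wt p : ℝ)) (crossF (1 / 8) (-1) (globalBlock (m : ℝ) ℓ)) <
        taylorFunctional2D (1 / 2) Sl.toFinset (fun p => (wt p : ℝ)) (crossF (1 / 8) (-1) (globalBlock (t : ℝ) ℓ)) := by
  unfold readoutCheckSpin at hchk
  simp only [Bool.and_eq_true, decide_eq_true_eq, headSpinQf_eq_headSpinQ wt hdeg] at hchk
  obtain ⟨⟨⟨⟨⟨⟨⟨⟨⟨⟨⟨⟨⟨⟨⟨ht, ha⟩, hm⟩, hb⟩, hk⟩, hN⟩, ham⟩, htm⟩, hmb⟩, hbm⟩, hLa⟩, hULa⟩, hLt⟩, hULt⟩, hLb⟩, hULb⟩ :=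
    hchk
  obtain ⟨ht0, ht1⟩ := rangeOkSpin_sound ht
  obtain ⟨ha0, ha1⟩ := rangeOkSpin_sound ha
  obtain ⟨hm0, hm1⟩ := rangeOkSpin_sound hm
  obtain ⟨hb0, hb1⟩ := rangeOkSpin_sound hb
  obtain ⟨-, hUm⟩ := blockAction_mem_spin wt hnd hdeg ℓ hk hm0 hm1 hN
  obtain ⟨hLa', -⟩ := blockAction_mem_spin wt hnd hdeg ℓ hk ha0 ha1 hN
  obtain ⟨hLt', -⟩ := blockAction_mem_spin wt hnd hdeg ℓ hk ht0 ht1 hN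
  obtain ⟨hLb', -⟩ := blockAction_mem_spin wt hnd hdeg ℓ hk hb0 hb1 hN
  refine ⟨?_, ?_, ?_⟩
  · exact lt_of_enclosures_left (by exact_mod_cast ham) hUm hLa' (by exact_mod_cast hLa) (by exact_mod_cast hULa)
  · refine lt_of_enclosures_right (by exact_mod_cast hbm) hUm hLb' (by exact_mod_cast hLb) ?_
    have : (((2 * (headSpinQ wt Sl (1 / 8) ((m + ℓ) / 2) ((m - ℓ) / 2) N + errSpinQ wt Sl ℓ k N Λ)) : ℚ) : ℝ) <
        (((headSpinQ wt Sl (1 / 8) ((b + ℓ) / 2) ((b - ℓ) / 2) N - errSpinQ wt Sl ℓ k N Λ) : ℚ) : ℝ) := by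
      exact_mod_cast hULb
    push_cast at this ⊢
    linarith
  · exact lt_of_enclosures_left (by exact_mod_cast htm) hUm hLt' (by exact_mod_cast hLt) (by exact_mod_cast hULt)

end Summit.CriticalPhenomena.Ising3D.Control2D
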